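import Mathlib.Analysis.Matrix.Order
import Mathlib.Analysis.Fourier.FiniteAbelian.PontryaginDuality
import HarnessLib

/-!
# Crux `NonSimplyConnectedLatticeGap` (stmt-QuantumFields-16405), route `ConvexGribovBody`,
# line `twist-equipartition-blindness` — helper toward stub `stub_electricBlindness` (EBLIND):
# the abstract centre-Fourier trace bound (card (III), 't Hooft's `ker π`-duality, defect-free)

Finite-dimensional operator skeleton of "twist equipartition ⇒ electric blindness" for a positive
semidefinite transfer operator, in `Matrix n n ℂ` vocabulary (`Matrix.PosSemidef`, `Matrix.trace`,
`AddChar`). Reading: `X = P_m 𝕋^L` (PSD, the magnetic block of the `L`-th power of the PSD transfer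
operator of the splitting weight), `U k` the unitary action of the finite abelian centre `ker π`
(written additively as `α`) by temporal centre flips, commuting with `X`; `A` a Hermitian observable
with `-a ≤ A ≤ a`; `Z(k) = tr (U k X)` the twisted partition functions, `N(k) = tr (U k X A)`.

* `trace_mul_posSemidef_nonneg`, `norm_trace_mul_le_of_loewner`: `B ⪰ 0`, `-a ≤ A ≤ a` ⟹
  `‖tr (B A)‖ ≤ a · Re tr B` (positivity of the transfer operator gives `|tr_e(𝕋^L Â)| ≤ ‖A‖ Z_e`).
* `posSemidef_proj_mul`: an orthogonal projection commuting with `X ⪰ 0` gives `P X ⪰ 0`.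
* `charProj_*`: the character ("electric flux") projections
  `P_ψ = |α|⁻¹ Σ_b ψ(-b) U b` are Hermitian idempotents commuting with `X`, and
  `U k = Σ_ψ ψ(k) P_ψ` (finite abelian Fourier inversion, `AddChar.sum_apply_eq_ite`).
* `charProj_trace_le_of_equipartition`: equipartition `‖Z(k) − Z(0)‖ ≤ δ Re Z(0)` for all `k` ⟹
  `‖tr (P_ψ X)‖ ≤ δ Re Z(0)` for every non-trivial `ψ` (electric fluxes are suppressed).
* `centreFourier_traceBlindness`: all together,
  `‖N(k) Z(0) − N(0) Z(k)‖ ≤ (2|α| + 1) a δ (Re Z(0))²` — the cross-multiplied ("junk-safe")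
  form of `|⟨A⟩_k − ⟨A⟩_0| ≲ a δ`, the shape of EBLIND's conclusion.

What this does NOT contain (the honest residual of the stub, triage S2): robustness of these trace
(in)equalities under the dilute, configuration-dependent defect insertions (monopoles and label
noise of density `e^{-cβ}`) that relate the interface labelling `cls` to the clean twisted traces.
-/

set_option autoImplicit false

namespace Summit.QuantumFields.YangMills.Theorems.NonSimplyConnectedLatticeGap

open scoped ComplexOrder MatrixOrder BigOperators
open Matrix

section TraceBounds

variable {n : Type*} [Fintype n] [DecidableEq n]

/-- The trace of a product of two positive semidefinite complex matrices is non-negative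
(`tr (B C) = tr (√B C √B) ≥ 0`). -/
theorem trace_mul_posSemidef_nonneg {B C : Matrix n n ℂ} (hB : B.PosSemidef)
    (hC : C.PosSemidef) : 0 ≤ (B * C).trace := by
  set S : Matrix n n ℂ := CFC.sqrt B with hSdef
  have hSS : S * S = B := CFC.sqrt_mul_sqrt_self B hB.nonneg
  have hSH : Sᴴ = S := (CFC.sqrt_nonneg B).posSemidef.isHermitian
  have h := (hC.mul_mul_conjTranspose_same S).trace_nonneg
  rw [hSH, Matrix.trace_mul_cycle, hSS] at h
  exact h

/-- **Positivity gives the observable trace inequality.** If `B ⪰ 0` and the observable `A`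
satisfies `-a·1 ≤ A ≤ a·1` in the Loewner order (a Hermitian observable of norm `≤ a`), then
`‖tr (B A)‖ ≤ a · Re tr B`. (Read `B = P_e P_m 𝕋^L`: `|tr_{m,e}(𝕋^L Â)| ≤ ‖A‖ Z_{m,e}`.) -/
theorem norm_trace_mul_le_of_loewner {B A : Matrix n n ℂ} {a : ℝ} (hB : B.PosSemidef)
    (hA₁ : ((a : ℂ) • (1 : Matrix n n ℂ) - A).PosSemidef)
    (hA₂ : ((a : ℂ) • (1 : Matrix n n ℂ) + A).PosSemidef) :
    ‖(B * A).trace‖ ≤ a * B.trace.re := by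
  have h1 := trace_mul_posSemidef_nonneg hB hA₁
  have h2 := trace_mul_posSemidef_nonneg hB hA₂
  rw [Matrix.mul_sub, Matrix.mul_smul, Matrix.mul_one, Matrix.trace_sub, Matrix.trace_smul,
    smul_eq_mul] at h1
  rw [Matrix.mul_add, Matrix.mul_smul, Matrix.mul_one, Matrix.trace_add, Matrix.trace_smul,
    smul_eq_mul] at h2
  obtain ⟨h1re, h1im⟩ := Complex.nonneg_iff.mp h1
  obtain ⟨h2re, h2im⟩ := Complex.nonneg_iff.mp h2
  simp only [Complex.sub_re, Complex.sub_im, Complex.add_re, Complex.add_im, Complex.mul_re,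
    Complex.mul_im, Complex.ofReal_re, Complex.ofReal_im, zero_mul, sub_zero, add_zero]
    at h1re h1im h2re h2im
  have him : (B * A).trace.im = 0 := by linarith
  have hz : (B * A).trace = (((B * A).trace.re : ℝ) : ℂ) :=
    Complex.ext (by simp) (by simp [him])
  rw [hz, Complex.norm_real, Real.norm_eq_abs]
  exact abs_le.mpr ⟨by linarith, by linarith⟩

omit [DecidableEq n] in
/-- An orthogonal projection `P` (Hermitian idempotent) commuting with `X ⪰ 0` gives
`P X = P X Pᴴ ⪰ 0`. (Read: `P = P_e P_m`, `X = 𝕋^L`.) -/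
theorem posSemidef_proj_mul {P X : Matrix n n ℂ} (hP : P.IsHermitian) (hPP : P * P = P)
    (hPX : P * X = X * P) (hX : X.PosSemidef) : (P * X).PosSemidef := by
  have h : P * X = P * X * Pᴴ := by
    rw [hP.eq, Matrix.mul_assoc, ← hPX, ← Matrix.mul_assoc, hPP]
  rw [h]
  exact hX.mul_mul_conjTranspose_same P

/-- Powers of a PSD transfer operator commute with whatever the operator commutes with, and the
projected power `P 𝕋^L` is PSD. -/
theorem posSemidef_proj_mul_pow {P T : Matrix n n ℂ} (hP : P.IsHermitian) (hPP : P * P = P)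
    (hPT : P * T = T * P) (hT : T.PosSemidef) (L : ℕ) : (P * T ^ L).PosSemidef :=
  posSemidef_proj_mul hP hPP ((Commute.pow_right hPT L : Commute P (T ^ L))) (hT.pow L)

end TraceBounds

section CharacterProjections

variable {n : Type*} [Fintype n]
variable {α : Type*} [AddCommGroup α] [Fintype α]

/-- The character projection `P_ψ = |α|⁻¹ Σ_b ψ(-b) U b` commutes with everything the `U b`
commute with. -/
theorem charProj_comm (U : α → Matrix n n ℂ) (X : Matrix n n ℂ)
    (hUX : ∀ b, U b * X = X * U b) (ψ : AddChar α ℂ) :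
    ((Fintype.card α : ℂ)⁻¹ • ∑ b : α, ψ (-b) • U b) * X
      = X * ((Fintype.card α : ℂ)⁻¹ • ∑ b : α, ψ (-b) • U b) := by
  rw [Matrix.smul_mul, Matrix.mul_smul, Finset.sum_mul, Finset.mul_sum]
  congr 1
  refine Finset.sum_congr rfl fun b _ => ?_
  rw [Matrix.smul_mul, Matrix.mul_smul, hUX]

omit [Fintype n] in
/-- The character projection is Hermitian when `U` is a unitary action (`(U b)ᴴ = U (-b)`). -/
theorem charProj_isHermitian (U : α → Matrix n n ℂ) (hUstar : ∀ b, (U b)ᴴ = U (-b))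
    (ψ : AddChar α ℂ) :
    ((Fintype.card α : ℂ)⁻¹ • ∑ b : α, ψ (-b) • U b).IsHermitian := by
  unfold Matrix.IsHermitian
  rw [Matrix.conjTranspose_smul, Matrix.conjTranspose_sum]
  have hc : star ((Fintype.card α : ℂ)⁻¹) = (Fintype.card α : ℂ)⁻¹ := by
    rw [star_inv₀, Complex.star_def, Complex.conj_natCast]
  rw [hc]
  congr 1
  simp_rw [Matrix.conjTranspose_smul, hUstar, AddChar.map_neg_eq_conj, Complex.star_def,
    Complex.conj_conj]
  exact Fintype.sum_equiv (Equiv.neg α) _ _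
    (fun b => by simp only [Equiv.neg_apply, AddChar.map_neg_eq_conj, Complex.conj_conj])

/-- The character projection is idempotent when `U` is an action (`U (a + b) = U a * U b`). -/
theorem charProj_mul_self (U : α → Matrix n n ℂ) (hUadd : ∀ a b, U (a + b) = U a * U b)
    (ψ : AddChar α ℂ) :
    ((Fintype.card α : ℂ)⁻¹ • ∑ b : α, ψ (-b) • U b)
        * ((Fintype.card α : ℂ)⁻¹ • ∑ b : α, ψ (-b) • U b)
      = (Fintype.card α : ℂ)⁻¹ • ∑ b : α, ψ (-b) • U b := by
  have hc : (Fintype.card α : ℂ) ≠ 0 := Nat.cast_ne_zero.mpr Fintype.card_ne_zero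
  rw [Matrix.smul_mul, Matrix.mul_smul, Finset.sum_mul]
  simp_rw [Finset.mul_sum, Matrix.smul_mul, Matrix.mul_smul, smul_smul, ← hUadd]
  have inner : ∀ a : α, ∑ b, (ψ (-a) * ψ (-b)) • U (a + b) = ∑ d, ψ (-d) • U d := by
    intro a
    refine Fintype.sum_equiv (Equiv.addLeft a) _ _ (fun b => ?_)
    simp only [Equiv.coe_addLeft, neg_add, AddChar.map_add_eq_mul]
  simp_rw [inner, Finset.sum_const, Finset.card_univ, ← Nat.cast_smul_eq_nsmul ℂ, smul_smul]
  congr 1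
  field_simp

omit [Fintype n] in
/-- **Finite abelian Fourier inversion for the centre action**: `U a = Σ_ψ ψ(a) P_ψ`. -/
theorem sum_char_smul_charProj [DecidableEq α] (U : α → Matrix n n ℂ) (a : α) :
    ∑ ψ : AddChar α ℂ, ψ a • ((Fintype.card α : ℂ)⁻¹ • ∑ b : α, ψ (-b) • U b) = U a := by
  have hc : (Fintype.card α : ℂ) ≠ 0 := Nat.cast_ne_zero.mpr Fintype.card_ne_zero
  have step1 : ∀ ψ : AddChar α ℂ, ψ a • ((Fintype.card α : ℂ)⁻¹ • ∑ b : α, ψ (-b) • U b)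
      = (Fintype.card α : ℂ)⁻¹ • ∑ b : α, ψ (a - b) • U b := by
    intro ψ
    rw [smul_comm, Finset.smul_sum]
    congr 1
    refine Finset.sum_congr rfl fun b _ => ?_
    rw [smul_smul, sub_eq_add_neg, AddChar.map_add_eq_mul]
  simp_rw [step1]
  rw [← Finset.smul_sum, Finset.sum_comm]
  simp_rw [← Finset.sum_smul]
  have step2 : ∀ b : α, (∑ ψ : AddChar α ℂ, ψ (a - b)) • U b
      = if a = b then (Fintype.card α : ℂ) • U b else 0 := by
    intro b
    rw [AddChar.sum_apply_eq_ite]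
    by_cases h : a = b
    · subst h
      simp
    · have h' : a - b ≠ 0 := sub_ne_zero.mpr h
      simp [h, h']
  simp_rw [step2, Finset.sum_ite_eq, Finset.mem_univ, if_true, smul_smul, inv_mul_cancel₀ hc,
    one_smul]

/-- **Equipartition suppresses the non-trivial fluxes.** If the twisted traces
`Z(b) = tr (U b X)` satisfy `‖Z(b) − Z(0)‖ ≤ δ · Re Z(0)` for all `b` (with `Z(0) = tr X`), then for
every non-trivial character `ψ`, `‖tr (P_ψ X)‖ ≤ δ · Re tr X`
(`tr (P_ψ X) = |α|⁻¹ Σ_b ψ(-b) (Z(b) − Z(0))` because `Σ_b ψ(-b) = 0`). -/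
theorem charProj_trace_le_of_equipartition (U : α → Matrix n n ℂ) (X : Matrix n n ℂ)
    (ψ : AddChar α ℂ) (hψ : ψ ≠ 0) (δ : ℝ)
    (hequi : ∀ b, ‖(U b * X).trace - X.trace‖ ≤ δ * X.trace.re) :
    ‖(((Fintype.card α : ℂ)⁻¹ • ∑ b : α, ψ (-b) • U b) * X).trace‖ ≤ δ * X.trace.re := by
  have hc : (Fintype.card α : ℂ) ≠ 0 := Nat.cast_ne_zero.mpr Fintype.card_ne_zero
  have hcpos : (0 : ℝ) < Fintype.card α := Nat.cast_pos.mpr Fintype.card_pos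
  have hsum : ∑ b : α, ψ (-b) = 0 := by
    rw [show (∑ b : α, ψ (-b)) = ∑ b : α, ψ b from
      Fintype.sum_equiv (Equiv.neg α) _ _ (fun b => by simp)]
    exact AddChar.sum_eq_zero_iff_ne_zero.mpr hψ
  have htr : (((Fintype.card α : ℂ)⁻¹ • ∑ b : α, ψ (-b) • U b) * X).trace
      = (Fintype.card α : ℂ)⁻¹ * ∑ b, ψ (-b) * ((U b * X).trace - X.trace) := by
    rw [Matrix.smul_mul, Matrix.trace_smul, Finset.sum_mul, Matrix.trace_sum, smul_eq_mul]
    simp_rw [Matrix.smul_mul, Matrix.trace_smul, smul_eq_mul, mul_sub]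
    rw [Finset.sum_sub_distrib, ← Finset.sum_mul, hsum, zero_mul, sub_zero]
  rw [htr, norm_mul, norm_inv, Complex.norm_natCast]
  calc (Fintype.card α : ℝ)⁻¹ * ‖∑ b, ψ (-b) * ((U b * X).trace - X.trace)‖
      ≤ (Fintype.card α : ℝ)⁻¹ * ∑ b, ‖ψ (-b) * ((U b * X).trace - X.trace)‖ := by
        gcongr
        exact norm_sum_le _ _
    _ ≤ (Fintype.card α : ℝ)⁻¹ * ∑ b : α, (δ * X.trace.re) := by
        gcongr with b
        rw [norm_mul, AddChar.norm_apply, one_mul]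
        exact hequi b
    _ = δ * X.trace.re := by
        rw [Finset.sum_const, Finset.card_univ, nsmul_eq_mul]
        field_simp

end CharacterProjections

section Blindness

/-- **Abstract electric blindness (card (III) of the line, defect-free).** Let `X ⪰ 0`
(read `P_m 𝕋^L`), `U` a unitary action of the finite abelian centre `α` commuting with `X`
(temporal centre flips), `A` an observable with `-a ≤ A ≤ a`, `0 ≤ a`, and suppose twist
equipartition `‖tr (U k X) − tr X‖ ≤ δ Re tr X` for all `k`, `0 ≤ δ`. Then the twisted and
untwisted un-normalised expectations are proportional up to `O(a δ)`:
`‖tr (U k X A) · tr X − tr (X A) · tr (U k X)‖ ≤ (2|α| + 1) a δ (Re tr X)²`.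
Mechanism: `tr (U k X A) = Σ_ψ ψ(k) tr (P_ψ X A)` (Fourier inversion), `|tr (P_ψ X A)| ≤ a Re tr (P_ψ X)`
(positivity), `|tr (P_ψ X)| ≤ δ Re tr X` for `ψ ≠ 0` (equipartition). -/
theorem centreFourier_traceBlindness : ∀ (n : Type) [Fintype n] [DecidableEq n] (α : Type)
    [AddCommGroup α] [Fintype α] [DecidableEq α] (U : α → Matrix n n ℂ) (X A : Matrix n n ℂ)
    (a δ : ℝ), U 0 = 1 → (∀ x y : α, U (x + y) = U x * U y) → (∀ x : α, (U x)ᴴ = U (-x)) →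
    X.PosSemidef → (∀ x : α, U x * X = X * U x) → 0 ≤ a →
    ((a : ℂ) • (1 : Matrix n n ℂ) - A).PosSemidef → ((a : ℂ) • (1 : Matrix n n ℂ) + A).PosSemidef →
    0 ≤ δ → (∀ x : α, ‖(U x * X).trace - X.trace‖ ≤ δ * X.trace.re) → ∀ x : α,
    ‖(U x * X * A).trace * X.trace - (X * A).trace * (U x * X).trace‖
      ≤ (2 * (Fintype.card α : ℝ) + 1) * a * δ * X.trace.re ^ 2 := by
  intro n _ _ α _ _ _ U X A a δ hU0 hUadd hUstar hX hUX ha hA₁ hA₂ hδ hequi x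
  -- the character projections and their three properties
  set P : AddChar α ℂ → Matrix n n ℂ :=
    fun ψ => (Fintype.card α : ℂ)⁻¹ • ∑ b : α, ψ (-b) • U b with hPdef
  have hPX : ∀ ψ, (P ψ * X).PosSemidef := fun ψ =>
    posSemidef_proj_mul (charProj_isHermitian U hUstar ψ) (charProj_mul_self U hUadd ψ)
      (charProj_comm U X hUX ψ) hX
  have hAψ : ∀ ψ, ‖(P ψ * X * A).trace‖ ≤ a * (P ψ * X).trace.re := fun ψ =>
    norm_trace_mul_le_of_loewner (hPX ψ) hA₁ hA₂
  have hZψ : ∀ ψ : AddChar α ℂ, ψ ≠ 0 → ‖(P ψ * X).trace‖ ≤ δ * X.trace.re := fun ψ hψ =>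
    charProj_trace_le_of_equipartition U X ψ hψ δ hequi
  -- Fourier expansion of the twisted observable traces
  have hexp : ∀ y : α, (U y * X * A).trace = ∑ ψ : AddChar α ℂ, ψ y * (P ψ * X * A).trace := by
    intro y
    conv_lhs => rw [← sum_char_smul_charProj U y]
    rw [Finset.sum_mul, Finset.sum_mul, Matrix.trace_sum]
    refine Finset.sum_congr rfl fun ψ _ => ?_
    rw [Matrix.smul_mul, Matrix.smul_mul, Matrix.trace_smul, smul_eq_mul]
  have hZ0re : 0 ≤ X.trace.re := (Complex.nonneg_iff.mp hX.trace_nonneg).1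
  have hZ0norm : ‖X.trace‖ = X.trace.re := by
    obtain ⟨hre, him⟩ := Complex.nonneg_iff.mp hX.trace_nonneg
    have hz : X.trace = ((X.trace.re : ℝ) : ℂ) := Complex.ext (by simp) (by simp [← him])
    rw [hz, Complex.norm_real, Real.norm_eq_abs, abs_of_nonneg hre, Complex.ofReal_re]
  -- (1) the difference of observable traces is carried by the non-trivial fluxes
  have hdiff : ‖(U x * X * A).trace - (X * A).trace‖
      ≤ 2 * Fintype.card α * a * δ * X.trace.re := by
    have h0 : (X * A).trace = ∑ ψ : AddChar α ℂ, (P ψ * X * A).trace := by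
      have := hexp 0
      simpa [hU0] using this
    rw [hexp x, h0, ← Finset.sum_sub_distrib]
    calc ‖∑ ψ : AddChar α ℂ, (ψ x * (P ψ * X * A).trace - (P ψ * X * A).trace)‖
        ≤ ∑ ψ : AddChar α ℂ, ‖ψ x * (P ψ * X * A).trace - (P ψ * X * A).trace‖ :=
          norm_sum_le _ _
      _ ≤ ∑ ψ : AddChar α ℂ, 2 * a * δ * X.trace.re := by
          refine Finset.sum_le_sum fun ψ _ => ?_
          by_cases hψ : ψ = 0
          · subst hψ
            simp only [AddChar.zero_apply, one_mul, sub_self, norm_zero]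
            positivity
          · rw [← sub_one_mul, norm_mul]
            have h1 : ‖ψ x - 1‖ ≤ 2 := by
              calc ‖ψ x - 1‖ ≤ ‖ψ x‖ + ‖(1 : ℂ)‖ := norm_sub_le _ _
                _ = 2 := by rw [AddChar.norm_apply, norm_one]; norm_num
            have h2 : ‖(P ψ * X * A).trace‖ ≤ a * (δ * X.trace.re) :=
              (hAψ ψ).trans (mul_le_mul_of_nonneg_left
                ((Complex.re_le_norm _).trans (hZψ ψ hψ)) ha)
            calc ‖ψ x - 1‖ * ‖(P ψ * X * A).trace‖ ≤ 2 * (a * (δ * X.trace.re)) :=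
                  mul_le_mul h1 h2 (norm_nonneg _) (by norm_num)
              _ = 2 * a * δ * X.trace.re := by ring
      _ = 2 * Fintype.card α * a * δ * X.trace.re := by
          rw [Finset.sum_const, Finset.card_univ, AddChar.card_eq, nsmul_eq_mul]
          ring
  -- (2) the untwisted observable trace is bounded by positivity
  have hN0 : ‖(X * A).trace‖ ≤ a * X.trace.re := norm_trace_mul_le_of_loewner hX hA₁ hA₂
  -- (3) equipartition for the partition functions themselves
  have hZ : ‖X.trace - (U x * X).trace‖ ≤ δ * X.trace.re := by
    rw [norm_sub_rev]; exact hequi x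
  -- assemble
  have key : (U x * X * A).trace * X.trace - (X * A).trace * (U x * X).trace
      = ((U x * X * A).trace - (X * A).trace) * X.trace
        + (X * A).trace * (X.trace - (U x * X).trace) := by ring
  rw [key]
  calc ‖((U x * X * A).trace - (X * A).trace) * X.trace
          + (X * A).trace * (X.trace - (U x * X).trace)‖
      ≤ ‖((U x * X * A).trace - (X * A).trace) * X.trace‖
          + ‖(X * A).trace * (X.trace - (U x * X).trace)‖ := norm_add_le _ _
    _ = ‖(U x * X * A).trace - (X * A).trace‖ * X.trace.re
          + ‖(X * A).trace‖ * ‖X.trace - (U x * X).trace‖ := by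
          rw [norm_mul, norm_mul, hZ0norm]
    _ ≤ (2 * Fintype.card α * a * δ * X.trace.re) * X.trace.re
          + (a * X.trace.re) * (δ * X.trace.re) := by
          gcongr
    _ = (2 * Fintype.card α + 1) * a * δ * X.trace.re ^ 2 := by ring

variable {n : Type} [Fintype n] [DecidableEq n]
variable {α : Type} [AddCommGroup α] [Fintype α] [DecidableEq α]

/-- **Abstract electric blindness, sector-probability shape.** Under the hypotheses of
`centreFourier_traceBlindness` and `δ ≤ 1/2`, the bound can be written with the product of the two
partition functions on the right (the `p_z p_w` of EBLIND): since `Re tr (U k X) ≥ (1 - δ) Re tr X`,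
`‖tr (U k X A) tr X − tr (X A) tr (U k X)‖ ≤ (4|α| + 2) a δ · Re tr X · Re tr (U k X)`. -/
theorem centreFourier_traceBlindness' (U : α → Matrix n n ℂ) (X A : Matrix n n ℂ) (a δ : ℝ)
    (hU0 : U 0 = 1) (hUadd : ∀ x y, U (x + y) = U x * U y) (hUstar : ∀ x, (U x)ᴴ = U (-x))
    (hX : X.PosSemidef) (hUX : ∀ x, U x * X = X * U x)
    (ha : 0 ≤ a) (hA₁ : ((a : ℂ) • (1 : Matrix n n ℂ) - A).PosSemidef)
    (hA₂ : ((a : ℂ) • (1 : Matrix n n ℂ) + A).PosSemidef)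
    (hδ : 0 ≤ δ) (hδ' : δ ≤ 1 / 2)
    (hequi : ∀ x, ‖(U x * X).trace - X.trace‖ ≤ δ * X.trace.re) (x : α) :
    ‖(U x * X * A).trace * X.trace - (X * A).trace * (U x * X).trace‖
      ≤ (4 * Fintype.card α + 2) * a * δ * X.trace.re * (U x * X).trace.re := by
  have h := centreFourier_traceBlindness n α U X A a δ hU0 hUadd hUstar hX hUX ha hA₁ hA₂ hδ hequi x
  have hZ0re : 0 ≤ X.trace.re := (Complex.nonneg_iff.mp hX.trace_nonneg).1
  -- `Re Z(x) ≥ (1 - δ) Re Z(0) ≥ Re Z(0) / 2`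
  have hre : X.trace.re - (U x * X).trace.re ≤ δ * X.trace.re := by
    have h1 : X.trace.re - (U x * X).trace.re = (X.trace - (U x * X).trace).re := by simp
    rw [h1]
    refine (Complex.re_le_norm _).trans ?_
    rw [norm_sub_rev]
    exact hequi x
  have hlow : X.trace.re ≤ 2 * (U x * X).trace.re := by nlinarith
  calc ‖(U x * X * A).trace * X.trace - (X * A).trace * (U x * X).trace‖
      ≤ (2 * Fintype.card α + 1) * a * δ * X.trace.re ^ 2 := h
    _ = ((2 * Fintype.card α + 1) * a * δ * X.trace.re) * X.trace.re := by ring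
    _ ≤ ((2 * Fintype.card α + 1) * a * δ * X.trace.re) * (2 * (U x * X).trace.re) := by
        apply mul_le_mul_of_nonneg_left hlow
        positivity
    _ = (4 * Fintype.card α + 2) * a * δ * X.trace.re * (U x * X).trace.re := by ring

end Blindness

end Summit.QuantumFields.YangMills.Theorems.NonSimplyConnectedLatticeGap
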